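import Literature.AlgebraicGeometry.AbelianSchemes.AbelianSchemeOverRigidity
import HarnessLib

/-!
# Morphisms from `A ×_S Y` to a group scheme decompose — [MumfordFogartyKirwan1994, Ch. 6 §1, Cor. 6.3] over a base
# (reduced total space of `A ×_S Y`)

[MumfordFogartyKirwan1994, Ch. 6 §1, Cor. 6.3 (p. 117)]: let `q₁ : X → S` be proper and flat with `H⁰(X_s, 𝒪_{X_s}) = κ(s)`
(e.g. an abelian scheme), `q₂ : Y → S` with a section `ε₂`, `Y` connected, `G` a group scheme over `S` and `f : X ×_S Y → G` an
`S`-morphism; then there are `S`-morphisms `g : X → G`, `h : Y → G` with `f = (g ∘ p₁) · (h ∘ p₂)` — in print a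
reduction to Cor. 6.2 over the base `Y`.  THIS FILE proves it for an ABELIAN SCHEME `A/S` with the total space of
`A ×_S Y` reduced, `Y` preconnected with a section `y₀ : S → Y`, `G/S` separated and locally of finite type
(`exists_eq_snd_comp_mul_fst_comp`; the printed order `(g ∘ p₁) · (h ∘ p₂)` and ours `(h ∘ p₂) · (g ∘ p₁)` differ by
which factor is normalised — `G` need not be commutative): apply ★ `AbelianSchemeOver.eq_section_mul_of_pullback_fst_comp_eq`
(Cor. 6.2 at a geometric fibre) to the abelian scheme `A ×_S Y → Y` (`A.baseChange Y.hom`), the `Y`-group scheme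
`G ×_S Y` and the two `Y`-morphisms `(x, y) ↦ f(x, y)`, `(x, y) ↦ f(x, y₀)`, which agree on the fibre over any point of
`y₀(S)`; §1 supplies the dictionary `Hom_Y(T, G ×_S Y) ≃ Hom_S(T, G)` (Mathlib `Over.mapPullbackAdj`) AS A GROUP MAP
(`homEquiv_mul`, `homEquiv_symm_mul`, `homEquiv_left`, `homEquiv_symm_left`), the general-`T` form of ★
`AbelianSchemeOver.fibrePointsBaseChangeEquiv`.

Theorems only; no instance, no def.  Cell hodgecm-mathlib, seat B-p18 (g13); `B-plan/M1PRIME-DAG.md` §3 N0.  HC_CM is proved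
only modulo the 7 printed citations until rung 0 closes; this file discharges none of them.

## References
* [MumfordFogartyKirwan1994] D. Mumford, J. Fogarty, F. Kirwan, *Geometric Invariant Theory*, 3rd ed. (1994), Ch. 6 §1,
  Cor. 6.2, Cor. 6.3 (p. 117).
* [GortzWedhorn2020] U. Görtz, T. Wedhorn, *Algebraic Geometry I*, 2nd ed. (2020), Section (4.7), (4.7.1) (base change
  adjunction on points).
-/

noncomputable section

universe u

open CategoryTheory CategoryTheory.Limits AlgebraicGeometry MonoidalCategory CartesianMonoidalCategory
open scoped MonObj CategoryTheory.Obj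

namespace Literature.AlgebraicGeometry.AbelianSchemes

/-! ### §1 `Hom_{S'}(T, G ×_S S') ≃ Hom_S(T, G)` is multiplicative (Mathlib `Over.mapPullbackAdj`) -/

section Adjunction

variable {S S' : Scheme.{u}} (g : S' ⟶ S) {G : Over S} [GrpObj G] {T : Over S'}

/-- **The base-change adjunction on hom-sets is a GROUP map**: for an `S`-group scheme `G`, `g : S' → S` and an
`S'`-scheme `T`, the bijection `Hom_S(T, G) ≃ Hom_{S'}(T, G ×_S S')`, `u ↦ (u, structure map)` (Mathlib
`(Over.mapPullbackAdj g).homEquiv`) is multiplicative for the pointwise group laws (`G ×_S S'` with the base-changed law,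
Mathlib `Functor.grpObjObj`) — [GortzWedhorn2020] (4.7.1); the general-`T` form of ★ `fibrePointsBaseChangeEquiv`.
[cite: GortzWedhorn2020, Section (4.7), (4.7.1) (p. 108)] -/
theorem homEquiv_mul (u₁ u₂ : (Over.map g).obj T ⟶ G) :
    (Over.mapPullbackAdj g).homEquiv T G (u₁ * u₂) =
      (Over.mapPullbackAdj g).homEquiv T G u₁ * (Over.mapPullbackAdj g).homEquiv T G u₂ := by
  erw [Adjunction.homEquiv_unit, Adjunction.homEquiv_unit, Adjunction.homEquiv_unit,
    Functor.map_mul (Over.pullback g) u₁ u₂, MonObj.comp_mul]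

/-- The inverse bijection `Hom_{S'}(T, G ×_S S') → Hom_S(T, G)`, `v ↦ pr_G ∘ v`, is multiplicative.
[cite: GortzWedhorn2020, Section (4.7), (4.7.1) (p. 108)] -/
theorem homEquiv_symm_mul (v₁ v₂ : T ⟶ (Over.pullback g).obj G) :
    ((Over.mapPullbackAdj g).homEquiv T G).symm (v₁ * v₂) =
      ((Over.mapPullbackAdj g).homEquiv T G).symm v₁ * ((Over.mapPullbackAdj g).homEquiv T G).symm v₂ := by
  apply ((Over.mapPullbackAdj g).homEquiv T G).injective
  rw [Equiv.apply_symm_apply, homEquiv_mul, Equiv.apply_symm_apply, Equiv.apply_symm_apply]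

/-- The inverse bijection preserves inverses. [cite: GortzWedhorn2020, Section (4.7), (4.7.1) (p. 108)] -/
theorem homEquiv_symm_inv (v : T ⟶ (Over.pullback g).obj G) :
    ((Over.mapPullbackAdj g).homEquiv T G).symm v⁻¹ = (((Over.mapPullbackAdj g).homEquiv T G).symm v)⁻¹ := by
  let φ : (T ⟶ (Over.pullback g).obj G) →* ((Over.map g).obj T ⟶ G) :=
    MonoidHom.mk' (fun v => ((Over.mapPullbackAdj g).homEquiv T G).symm v) (homEquiv_symm_mul g)
  exact map_inv φ v

omit [GrpObj G] in
/-- Underlying morphism of `v ↦ pr_G ∘ v`: `(homEquiv.symm v).left = v.left ≫ pr_G`.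
[cite: GortzWedhorn2020, Section (4.7), (4.7.1) (p. 108)] -/
theorem homEquiv_symm_left (v : T ⟶ (Over.pullback g).obj G) :
    (((Over.mapPullbackAdj g).homEquiv T G).symm v).left = v.left ≫ pullback.fst G.hom g := rfl

omit [GrpObj G] in
/-- Underlying morphism of `u ↦ (u, structure map)` followed by `pr_G` is `u`.
[cite: GortzWedhorn2020, Section (4.7), (4.7.1) (p. 108)] -/
theorem homEquiv_left_fst (u : (Over.map g).obj T ⟶ G) :
    ((Over.mapPullbackAdj g).homEquiv T G u).left ≫ pullback.fst G.hom g = u.left := by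
  have h := homEquiv_symm_left g ((Over.mapPullbackAdj g).homEquiv T G u)
  rw [Equiv.symm_apply_apply] at h
  exact h.symm

end Adjunction

/-! ### §2 [MumfordFogartyKirwan1994] Cor. 6.3 -/

namespace AbelianSchemeOver

variable {S : Scheme.{u}} (A : AbelianSchemeOver S)

/-- **[MumfordFogartyKirwan1994] Cor. 6.3 over a base** (reduced total space): let `A/S` be an abelian scheme, `Y` an
`S`-scheme with a section `y₀ : S → Y` and preconnected total space such that the total space of `A ×_S Y` is reduced,
and `G/S` a separated `S`-group scheme locally of finite type.  Then every `S`-morphism `f : A ×_S Y → G` decomposes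
as `f(x, y) = h(y) · f(x, y₀)`, i.e. `f = (p₂ ≫ h) · (p₁ ≫ g)` with `g = f(·, y₀) : A → G` and some `h : Y → G`
(namely `h(y) = f(e, y) · f(e, y₀)⁻¹`).  Proof: Cor. 6.2 at a geometric fibre
(★ `eq_section_mul_of_pullback_fst_comp_eq`) for the abelian scheme `A ×_S Y → Y`, the `Y`-group scheme `G ×_S Y` and the
two `Y`-morphisms `(x,y) ↦ f(x,y)`, `(x,y) ↦ f(x,y₀)`, which agree on the fibre over the point `y₀(s₀)`; the dictionary of
§1 translates back to `S`-morphisms. [cite: MumfordFogartyKirwan1994, Ch. 6 §1 Corollary 6.3 (p. 117)] -/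
theorem exists_eq_snd_comp_mul_fst_comp {Y G : Over S} [GrpObj G] [IsSeparated G.hom] [LocallyOfFiniteType G.hom]
    (y₀ : 𝟙_ (Over S) ⟶ Y) [PreconnectedSpace Y.left] [IsReduced (A.X ⊗ Y).left] (f : A.X ⊗ Y ⟶ G) :
    ∃ h : Y ⟶ G, f = (snd A.X Y ≫ h) * (fst A.X Y ≫ lift (𝟙 A.X) (toUnit A.X ≫ y₀) ≫ f) := by
  -- the abelian scheme `A ×_S Y → Y` and the `Y`-group scheme `G ×_S Y`
  let A' : AbelianSchemeOver Y.left := A.baseChange Y.hom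
  haveI : IsSeparated ((Over.pullback Y.hom).obj G).hom := inferInstanceAs (IsSeparated (pullback.snd G.hom Y.hom))
  haveI : IsReduced A'.X.left := ‹IsReduced (A.X ⊗ Y).left›
  -- `A ×_S Y` (product in `Over S`) is `A' = A ×_S Y` viewed over `S` through `Y`
  let e : A.X ⊗ Y ≅ (Over.map Y.hom).obj A'.X :=
    Over.isoMk (Iso.refl _) (by
      change 𝟙 _ ≫ pullback.snd A.X.hom Y.hom ≫ Y.hom = pullback.fst A.X.hom Y.hom ≫ A.X.hom
      rw [Category.id_comp, pullback.condition])
  have he_inv : ∀ u : A.X ⊗ Y ⟶ G, (e.inv ≫ u).left = u.left := fun u => by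
    rw [Over.comp_left]
    exact Category.id_comp _
  -- the constant section `c = y₀ ∘ (Y → S)` and the two morphisms `f`, `f(·, y₀)`
  let c : Y ⟶ Y := toUnit Y ≫ y₀
  let F₂ : A.X ⊗ Y ⟶ G := (A.X ◁ c) ≫ f
  have hF₂ : F₂ = fst A.X Y ≫ lift (𝟙 A.X) (toUnit A.X ≫ y₀) ≫ f := by
    change (A.X ◁ c) ≫ f = _
    rw [← Category.assoc]
    congr 1
    apply CartesianMonoidalCategory.hom_ext
    · rw [whiskerLeft_fst, Category.assoc, lift_fst, Category.comp_id]
    · rw [whiskerLeft_snd, Category.assoc, lift_snd, ← Category.assoc, ← Category.assoc]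
      congr 1
      exact toUnit_unique _ _
  let f₁ : A'.X ⟶ (Over.pullback Y.hom).obj G := (Over.mapPullbackAdj Y.hom).homEquiv A'.X G (e.inv ≫ f)
  let f₂ : A'.X ⟶ (Over.pullback Y.hom).obj G := (Over.mapPullbackAdj Y.hom).homEquiv A'.X G (e.inv ≫ F₂)
  have hf₁ : f₁.left ≫ pullback.fst G.hom Y.hom = f.left := (homEquiv_left_fst Y.hom (e.inv ≫ f)).trans (he_inv f)
  have hf₂ : f₂.left ≫ pullback.fst G.hom Y.hom = (A.X ◁ c).left ≫ f.left :=
    (homEquiv_left_fst Y.hom (e.inv ≫ F₂)).trans (he_inv F₂)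
  -- the witness: `h = (y ↦ f(e, y) · f(e, y₀)⁻¹)`, read back over `S`
  let j : Y ⟶ (Over.map Y.hom).obj (𝟙_ (Over Y.left)) := Over.homMk (𝟙 Y.left) (by
    change 𝟙 _ ≫ 𝟙 _ ≫ Y.hom = Y.hom
    rw [Category.id_comp, Category.id_comp])
  refine ⟨j ≫ ((Over.mapPullbackAdj Y.hom).homEquiv (𝟙_ (Over Y.left)) G).symm (η[A'.X] ≫ (f₁ * f₂⁻¹)), ?_⟩
  -- empty `Y`: nothing to prove
  rcases isEmpty_or_nonempty Y.left with hY | hY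
  · haveI : IsEmpty ↥(A.X ⊗ Y).left := ⟨fun x => hY.false ((snd A.X Y).left.base x)⟩
    ext : 1
    exact (isInitialOfIsEmpty (X := (A.X ⊗ Y).left)).hom_ext _ _
  obtain ⟨t₀⟩ := hY
  -- a geometric fibre over a point of `y₀(S)`, on which `f` and `f(·, y₀)` agree
  let y : S ⟶ Y.left := y₀.left
  have hy : y ≫ Y.hom = 𝟙 S := by
    change y₀.left ≫ Y.hom = _
    rw [Over.w y₀]
    rfl
  have hc : c.left = Y.hom ≫ y := rfl
  let s₀ : S := Y.hom.base t₀
  let t' : Spec (S.residueField s₀) ⟶ Y.left := S.fromSpecResidueField s₀ ≫ y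
  have ht'c : t' ≫ c.left = t' := by
    change (S.fromSpecResidueField s₀ ≫ y) ≫ c.left = S.fromSpecResidueField s₀ ≫ y
    rw [hc, Category.assoc, reassoc_of% hy]
  have w1 : (A.X ◁ c).left ≫ pullback.fst A.X.hom Y.hom = pullback.fst A.X.hom Y.hom :=
    congrArg CommaMorphism.left (whiskerLeft_fst A.X c)
  have w2 : (A.X ◁ c).left ≫ pullback.snd A.X.hom Y.hom = pullback.snd A.X.hom Y.hom ≫ c.left :=
    congrArg CommaMorphism.left (whiskerLeft_snd A.X c)
  have hK : pullback.fst A'.X.hom t' ≫ (A.X ◁ c).left = pullback.fst A'.X.hom t' := by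
    apply pullback.hom_ext
    · calc (pullback.fst A'.X.hom t' ≫ (A.X ◁ c).left) ≫ pullback.fst A.X.hom Y.hom
          = pullback.fst A'.X.hom t' ≫ ((A.X ◁ c).left ≫ pullback.fst A.X.hom Y.hom) := Category.assoc _ _ _
        _ = pullback.fst A'.X.hom t' ≫ pullback.fst A.X.hom Y.hom := congrArg (pullback.fst A'.X.hom t' ≫ ·) w1
    · calc (pullback.fst A'.X.hom t' ≫ (A.X ◁ c).left) ≫ pullback.snd A.X.hom Y.hom
          = pullback.fst A'.X.hom t' ≫ ((A.X ◁ c).left ≫ pullback.snd A.X.hom Y.hom) := Category.assoc _ _ _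
        _ = pullback.fst A'.X.hom t' ≫ (pullback.snd A.X.hom Y.hom ≫ c.left) :=
            congrArg (pullback.fst A'.X.hom t' ≫ ·) w2
        _ = (pullback.fst A'.X.hom t' ≫ A'.X.hom) ≫ c.left := (Category.assoc _ _ _).symm
        _ = (pullback.snd A'.X.hom t' ≫ t') ≫ c.left := by rw [pullback.condition]
        _ = pullback.snd A'.X.hom t' ≫ (t' ≫ c.left) := Category.assoc _ _ _
        _ = pullback.snd A'.X.hom t' ≫ t' := by rw [ht'c]
        _ = pullback.fst A'.X.hom t' ≫ A'.X.hom := pullback.condition.symm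
  have h12 : pullback.fst A'.X.hom t' ≫ f₁.left = pullback.fst A'.X.hom t' ≫ f₂.left := by
    apply pullback.hom_ext
    · calc (pullback.fst A'.X.hom t' ≫ f₁.left) ≫ pullback.fst G.hom Y.hom
          = pullback.fst A'.X.hom t' ≫ (f₁.left ≫ pullback.fst G.hom Y.hom) := Category.assoc _ _ _
        _ = pullback.fst A'.X.hom t' ≫ f.left := congrArg (pullback.fst A'.X.hom t' ≫ ·) hf₁
        _ = (pullback.fst A'.X.hom t' ≫ (A.X ◁ c).left) ≫ f.left := congrArg (· ≫ f.left) hK.symm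
        _ = pullback.fst A'.X.hom t' ≫ ((A.X ◁ c).left ≫ f.left) := Category.assoc _ _ _
        _ = pullback.fst A'.X.hom t' ≫ (f₂.left ≫ pullback.fst G.hom Y.hom) :=
            congrArg (pullback.fst A'.X.hom t' ≫ ·) hf₂.symm
        _ = (pullback.fst A'.X.hom t' ≫ f₂.left) ≫ pullback.fst G.hom Y.hom := (Category.assoc _ _ _).symm
    · calc (pullback.fst A'.X.hom t' ≫ f₁.left) ≫ pullback.snd G.hom Y.hom
          = pullback.fst A'.X.hom t' ≫ (f₁.left ≫ ((Over.pullback Y.hom).obj G).hom) := Category.assoc _ _ _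
        _ = pullback.fst A'.X.hom t' ≫ A'.X.hom := congrArg (pullback.fst A'.X.hom t' ≫ ·) (Over.w f₁)
        _ = pullback.fst A'.X.hom t' ≫ (f₂.left ≫ ((Over.pullback Y.hom).obj G).hom) :=
            congrArg (pullback.fst A'.X.hom t' ≫ ·) (Over.w f₂).symm
        _ = (pullback.fst A'.X.hom t' ≫ f₂.left) ≫ pullback.snd G.hom Y.hom := (Category.assoc _ _ _).symm
  -- Cor. 6.2 over the base `Y`
  have key := A'.eq_section_mul_of_pullback_fst_comp_eq f₁ f₂ (K := S.residueField s₀) t' h12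
  -- back to `S`-morphisms
  have hsymm : ((Over.mapPullbackAdj Y.hom).homEquiv A'.X G).symm f₁ = e.inv ≫ f := Equiv.symm_apply_apply _ _
  have hsymm₂ : ((Over.mapPullbackAdj Y.hom).homEquiv A'.X G).symm f₂ = e.inv ≫ F₂ := Equiv.symm_apply_apply _ _
  have hnat : ((Over.mapPullbackAdj Y.hom).homEquiv A'.X G).symm (toUnit A'.X ≫ η[A'.X] ≫ (f₁ * f₂⁻¹)) =
      (Over.map Y.hom).map (toUnit A'.X) ≫
        ((Over.mapPullbackAdj Y.hom).homEquiv (𝟙_ (Over Y.left)) G).symm (η[A'.X] ≫ (f₁ * f₂⁻¹)) :=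
    Adjunction.homEquiv_naturality_left_symm _ _ _
  have hj : e.hom ≫ (Over.map Y.hom).map (toUnit A'.X) = snd A.X Y ≫ j := by
    ext : 1
    rw [Over.comp_left, Over.comp_left, Over.map_map_left, Over.toUnit_left]
    change 𝟙 _ ≫ pullback.snd A.X.hom Y.hom = pullback.snd A.X.hom Y.hom ≫ 𝟙 _
    rw [Category.id_comp, Category.comp_id]
  have hmain : e.inv ≫ f = ((Over.map Y.hom).map (toUnit A'.X) ≫
      ((Over.mapPullbackAdj Y.hom).homEquiv (𝟙_ (Over Y.left)) G).symm (η[A'.X] ≫ (f₁ * f₂⁻¹))) * (e.inv ≫ F₂) := by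
    have k := congrArg ((Over.mapPullbackAdj Y.hom).homEquiv A'.X G).symm key
    rw [hsymm, homEquiv_symm_mul, hsymm₂, hnat] at k
    exact k
  rw [← hF₂, ← cancel_epi e.inv, MonObj.comp_mul, hmain,
    ← e.inv_hom_id_assoc ((Over.map Y.hom).map (toUnit A'.X) ≫ _), reassoc_of% hj]

end AbelianSchemeOver

end Literature.AlgebraicGeometry.AbelianSchemes

end
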